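import Summits.Ventures.Crystal3D.Theorems.StickyWulffConstantCoaxialWallLawSeamSealedRowZTermKitB
import HarnessLib

/-!
# Z-TERM WITNESS: the 21-ball window in which the payer is the target of five narrow movers (tables, separation, junk lemmas, the generic into-payer pair)
# (crux `CoaxialWallLaw`, stmt-Ventures-19481; line `WallLedgerF`, skeleton 'CoaxialWallLawCertificates'; toward `not_unionCoreSealedCapWin₃`, cf-p1 (cclxxxiii)(2))

HONEST FRAMING. Venture `Summits/Ventures/Crystal3D` (cell `crystal3d-full`), helper `--supports` stmt-Ventures-19481; sequel of '…SeamSealedRowZTermKitB', data of the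
refutation in '…SeamSealedRowRefuted'.  Memo HOME/wall-19481-p1/g20/ZTERM-g20.md (witness W5, calc/witness5.json).
* `Yc : Fin 21 → ℚ³` — THE WITNESS in rational cubic coordinates (ball `= cubicVecQ (Yc i)`): row `0` the payer `z = 0`; rows `1…12` five NARROW SPIKES INTO `z`
  (movers `2 = (−1,−1,0)`, `3 = (−1,0,−1)` in the identity frame with basal roots `(1,1,0)`, `(1,0,1)`; movers `7 = (1,1,−4)/3`, `9 = (1,1,4)/3`, `10 = (1,4,1)/3` in the
  one-letter frames `Fw [cubeNormal 6]`, `Fw [cubeNormal 7]`; predecessors `1, 5, 6, 8, 12`; further reading balls `4, 11`); rows `13…20` eight JUNK balls, one touching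
  the payer and one touching each of its seven contacts, at prime-denominator rational points chosen so that (i) each junk ball has EXACTLY ONE contact and (ii) the
  MODULE OBSTRUCTION `6 (c_j − c_y)·(c_{y′} − c_y) ∉ ℤ` holds for all `K`-balls `y ≠ y′` (`tab_obst`);
* table facts by kernel `decide` (`tab_sep`, `tab_window`, `tab_contact`, `tab_tgt`, `tab_obst`) and their transfer: `Yset_separated`, `Yset_window`, `card_contacts_zero`
  (the payer has `8` contacts), `junk_contact`, `junk_obstruction`, `mem_Kset_of_capsTriangleIn`, `mem_Kset_of_starSiteIn` (`K` := the 13 non-junk balls is cap- and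
  star-closed in the window);
* the window systems `SB`, `SH` of `UnionCoreSealedCapWin₃`; **`isEndPairA_zero_of_data`** — a narrow mover INTO the payer from table-shaped data (the payer is not moving:
  `d ∉ X` kills FULL and NARROW, `≤ 8` contacts kill TWIN); `pieceOf_subset_unionCore_of_data`; admissibility of the empty chain (`adm_refl`) and of one-letter chains
  (`frame1 c := SB.Fw [cubeNormal c]`, `adm_frame1`).
WHAT THIS IS NOT: no statement about any stub yet (that is the sequel); F-C1 not moved.
-/

noncomputable section

namespace Summit.Ventures.Crystal3D.Theorems

namespace ZTerm

open Summit.Ventures.Crystal3D Finset NearIdentity TailResidue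
open scoped InnerProductSpace

/-! ### The witness tables -/

/-- **THE WITNESS `Y` (21 balls) in rational cubic coordinates** (point `= cubicVecQ (Yc i)`, i.e. `c/√2` in the orthonormal cubic frame of `Λ₀`):
`0` the payer `z`; `1…12` the spikes (movers `2, 3, 7, 9, 10`, their predecessors `1, 5, 6, 8, 12`, the further reading balls `4, 11`); `13…20` the junk. -/
def Yc : Fin 21 → Fin 3 → ℚ :=
  ![![0, 0, 0], ![-2, -2, 0], ![-1, -1, 0], ![-1, 0, -1], ![0, -1, -1], ![-2, 0, -2], ![2/3, 2/3, -8/3], ![1/3, 1/3, -4/3], ![2/3, 2/3, 8/3],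
    ![1/3, 1/3, 4/3], ![1/3, 4/3, 1/3], ![4/3, 1/3, 1/3], ![2/3, 8/3, 2/3],
    ![-91/97, 69/97, 76/97], ![-35/67, -112/67, 77/67], ![-70/89, 116/89, -134/89], ![60/61, -72/61, 0], ![521/303, 44/303, -467/303],
    ![82/183, -155/183, 385/183], ![-17/201, 463/201, -122/201], ![487/183, 136/183, 13/183]]

/-- The junk ball `13 + m` touches exactly its TARGET `tgt (13 + m)`; on `K` the table is the identity (unused). -/
def tgt : Fin 21 → Fin 21 := ![0, 1, 2, 3, 4, 5, 6, 7, 8, 9, 10, 11, 12, 0, 2, 3, 4, 7, 9, 10, 11]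

/-- The whole window. -/
def Yset : Finset (EuclideanSpace ℝ (Fin 3)) := Finset.univ.image fun i => cubicVecQ (Yc i)

/-- The NON-JUNK balls `K` (indices `< 13`): the payer and the five spikes. -/
def Kset : Finset (EuclideanSpace ℝ (Fin 3)) := (Finset.univ.filter fun i : Fin 21 => i.val < 13).image fun i => cubicVecQ (Yc i)

/-! ### Table facts (kernel `decide`) -/

/-- The coordinate table is injective. -/
theorem Yc_injective : Function.Injective Yc := by
  intro i j h
  have : ∀ i j : Fin 21, Yc i = Yc j → i = j := by decide +kernel
  exact this i j h

/-- Pairwise `1`-separation in the table: `|cᵢ − cⱼ|² ≥ 2`. -/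
theorem tab_sep : ∀ i j : Fin 21, i ≠ j → 2 ≤ qdot (Yc i - Yc j) (Yc i - Yc j) := by decide +kernel

/-- Everything within `3` of the payer: `|cᵢ|² ≤ 18`. -/
theorem tab_window : ∀ i : Fin 21, qdot (Yc i - 0) (Yc i - 0) ≤ 2 * 3 * 3 := by decide +kernel

/-- Contacts in the table: `|cᵢ − cⱼ|² = 2` only between `K`-balls or between a junk ball and its target. -/
theorem tab_contact : ∀ i j : Fin 21, qdot (Yc i - Yc j) (Yc i - Yc j) = 2 → (i.val < 13 ∧ j.val < 13) ∨ (13 ≤ i.val ∧ j = tgt i) ∨ (13 ≤ j.val ∧ i = tgt j) := by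
  decide +kernel

/-- Junk targets are `K`-balls at distance `1`. -/
theorem tab_tgt : ∀ j : Fin 21, 13 ≤ j.val → (tgt j).val < 13 ∧ qdot (Yc j - Yc (tgt j)) (Yc j - Yc (tgt j)) = 2 := by decide +kernel

/-- **THE MODULE OBSTRUCTION TABLE**: `6·(c_j − c_y)·(c_{y′} − c_y) ∉ ℤ` for every junk `j` and `K`-balls `y ≠ y′`. -/
theorem tab_obst : ∀ j y y' : Fin 21, 13 ≤ j.val → y.val < 13 → y'.val < 13 → y ≠ y' → (6 * qdot (Yc j - Yc y) (Yc y' - Yc y)).den ≠ 1 := by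
  decide +kernel

/-- The payer's row: `c₀ = 0`. -/
theorem Yc_zero : Yc 0 = 0 := by decide +kernel

/-! ### Transfer to `ℝ³` -/

/-- Membership in `Y` through the table. -/
theorem mem_Yset_iff {x : EuclideanSpace ℝ (Fin 3)} : x ∈ Yset ↔ ∃ i, x = cubicVecQ (Yc i) := by
  simp only [Yset, Finset.mem_image, Finset.mem_univ, true_and, eq_comm]

/-- Membership in `K` through the table. -/
theorem mem_Kset_iff {x : EuclideanSpace ℝ (Fin 3)} : x ∈ Kset ↔ ∃ i : Fin 21, i.val < 13 ∧ x = cubicVecQ (Yc i) := by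
  simp only [Kset, Finset.mem_image, Finset.mem_filter, Finset.mem_univ, true_and, eq_comm]

/-- Rows are balls of `Y`. -/
theorem mem_Yset (i : Fin 21) : cubicVecQ (Yc i) ∈ Yset := mem_Yset_iff.2 ⟨i, rfl⟩

/-- The first thirteen rows are balls of `K`. -/
theorem mem_Kset {i : Fin 21} (hi : i.val < 13) : cubicVecQ (Yc i) ∈ Kset := mem_Kset_iff.2 ⟨i, hi, rfl⟩

/-- `K ⊆ Y`. -/
theorem Kset_subset_Yset : Kset ⊆ Yset := fun x hx => by
  obtain ⟨i, -, rfl⟩ := mem_Kset_iff.1 hx; exact mem_Yset i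

/-- Index of a `K`-ball. -/
theorem idx_lt_of_mem_Kset {i : Fin 21} (h : cubicVecQ (Yc i) ∈ Kset) : i.val < 13 := by
  obtain ⟨i', hi', e⟩ := mem_Kset_iff.1 h
  rw [Yc_injective (cubicVecQ_injective e)]; exact hi'

/-- A concrete rational point is in `Y` iff it is a row of the table. -/
theorem cubicVecQ_mem_Yset_iff (c : Fin 3 → ℚ) : cubicVecQ c ∈ Yset ↔ ∃ i : Fin 21, Yc i = c := by
  rw [mem_Yset_iff]
  exact ⟨fun ⟨i, h⟩ => ⟨i, (cubicVecQ_injective h).symm⟩, fun ⟨i, h⟩ => ⟨i, by rw [h]⟩⟩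

/-- A concrete rational point is in `K` iff it is one of the first thirteen rows. -/
theorem cubicVecQ_mem_Kset_iff (c : Fin 3 → ℚ) : cubicVecQ c ∈ Kset ↔ ∃ i : Fin 21, i.val < 13 ∧ Yc i = c := by
  rw [mem_Kset_iff]
  exact ⟨fun ⟨i, hi, h⟩ => ⟨i, hi, (cubicVecQ_injective h).symm⟩, fun ⟨i, hi, h⟩ => ⟨i, hi, by rw [h]⟩⟩

/-- The payer is the origin. -/
theorem cubicVecQ_Yc_zero : cubicVecQ (Yc 0) = 0 := by rw [Yc_zero, cubicVecQ_zero]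

/-- The payer is a ball of `Y`. -/
theorem zero_mem_Yset : (0 : EuclideanSpace ℝ (Fin 3)) ∈ Yset := by rw [← cubicVecQ_Yc_zero]; exact mem_Yset 0

/-- The payer is a ball of `K`. -/
theorem zero_mem_Kset : (0 : EuclideanSpace ℝ (Fin 3)) ∈ Kset := by rw [← cubicVecQ_Yc_zero]; exact mem_Kset (by decide)

/-- **`Y` is `1`-separated.** -/
theorem Yset_separated : ∀ p ∈ Yset, ∀ q ∈ Yset, p ≠ q → 1 ≤ dist p q := by
  intro p hp q hq hne
  obtain ⟨i, rfl⟩ := mem_Yset_iff.1 hp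
  obtain ⟨j, rfl⟩ := mem_Yset_iff.1 hq
  have hij : i ≠ j := fun h => hne (by rw [h])
  exact (one_le_dist_cubicVecQ_iff _ _).2 (tab_sep i j hij)

/-- **`Y` lies in the payer window `B̄(0, 3)`.** -/
theorem Yset_window : ∀ y ∈ Yset, dist (0 : EuclideanSpace ℝ (Fin 3)) y ≤ 3 := by
  intro y hy
  obtain ⟨i, rfl⟩ := mem_Yset_iff.1 hy
  rw [dist_comm, ← cubicVecQ_zero]
  exact (dist_cubicVecQ_le_iff _ _ (by norm_num)).2 (by have := tab_window i; push_cast at this ⊢; linarith)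

/-- Contacts between rows, read off the table. -/
theorem dist_Yc_eq_one_iff (i j : Fin 21) : dist (cubicVecQ (Yc i)) (cubicVecQ (Yc j)) = 1 ↔ qdot (Yc i - Yc j) (Yc i - Yc j) = 2 :=
  dist_cubicVecQ_eq_one_iff _ _

open scoped Classical in
/-- Counting contacts in `Y` through the table. -/
theorem card_contacts_Yset (c : Fin 3 → ℚ) :
    (Yset.filter fun q => dist (cubicVecQ c) q = 1).card = (Finset.univ.filter fun j : Fin 21 => qdot (c - Yc j) (c - Yc j) = 2).card := by
  rw [Yset, Finset.filter_image, Finset.card_image_of_injOn fun i _ j _ h => Yc_injective (cubicVecQ_injective h)]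
  congr 1
  ext j
  simp only [Finset.mem_filter, Finset.mem_univ, true_and, dist_cubicVecQ_eq_one_iff]

open scoped Classical in
/-- Counting contacts in `K` through the table. -/
theorem card_contacts_Kset (c : Fin 3 → ℚ) :
    (Kset.filter fun q => dist (cubicVecQ c) q = 1).card = ((Finset.univ.filter fun i : Fin 21 => i.val < 13).filter fun j => qdot (c - Yc j) (c - Yc j) = 2).card := by
  rw [Kset, Finset.filter_image, Finset.card_image_of_injOn fun i _ j _ h => Yc_injective (cubicVecQ_injective h)]
  congr 1
  ext j
  simp only [Finset.mem_filter, Finset.mem_univ, true_and, dist_cubicVecQ_eq_one_iff]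

open scoped Classical in
/-- **The payer has eight contacts** (seven spike balls and one junk ball). -/
theorem card_contacts_zero : (Yset.filter fun q => dist (0 : EuclideanSpace ℝ (Fin 3)) q = 1).card = 8 := by
  rw [← cubicVecQ_Yc_zero, card_contacts_Yset]; decide +kernel

/-! ### Junk: single contact, contacts in `K`, module obstruction -/

/-- **A junk ball's only contact is its target, a `K`-ball.** -/
theorem junk_contact {x a : EuclideanSpace ℝ (Fin 3)} (hx : x ∈ Yset) (hxK : x ∉ Kset) (ha : a ∈ Yset) (hd : dist x a = 1) :
    ∃ j : Fin 21, 13 ≤ j.val ∧ x = cubicVecQ (Yc j) ∧ a = cubicVecQ (Yc (tgt j)) ∧ a ∈ Kset := by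
  obtain ⟨j, rfl⟩ := mem_Yset_iff.1 hx
  obtain ⟨i, rfl⟩ := mem_Yset_iff.1 ha
  have hj : 13 ≤ j.val := by
    by_contra h
    exact hxK (mem_Kset (by omega))
  have h2 := (dist_Yc_eq_one_iff j i).1 hd
  rcases tab_contact j i h2 with ⟨hj', -⟩ | ⟨-, hi⟩ | ⟨hi13, hji⟩
  · omega
  · exact ⟨j, hj, rfl, by rw [hi], by rw [hi]; exact mem_Kset (tab_tgt j hj).1⟩
  · have := (tab_tgt i hi13).1
    rw [← hji] at this; omega

/-- Two contacts of a junk ball coincide. -/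
theorem junk_contacts_eq {x a b : EuclideanSpace ℝ (Fin 3)} (hx : x ∈ Yset) (hxK : x ∉ Kset) (ha : a ∈ Yset) (hb : b ∈ Yset) (hda : dist x a = 1)
    (hdb : dist x b = 1) : a = b := by
  obtain ⟨j, -, ej, ea, -⟩ := junk_contact hx hxK ha hda
  obtain ⟨j', -, ej', eb, -⟩ := junk_contact hx hxK hb hdb
  have : j = j' := Yc_injective (cubicVecQ_injective (ej.symm.trans ej'))
  rw [ea, eb, this]

/-- A contact of a junk ball is a `K`-ball. -/
theorem junk_contact_mem_Kset {x a : EuclideanSpace ℝ (Fin 3)} (hx : x ∈ Yset) (hxK : x ∉ Kset) (ha : a ∈ Yset) (hd : dist x a = 1) : a ∈ Kset := by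
  obtain ⟨-, -, -, -, h⟩ := junk_contact hx hxK ha hd; exact h

/-- **THE MODULE OBSTRUCTION in `ℝ³`**: for a junk ball `x` and `K`-balls `y ≠ y′`, `⟪x − y, y′ − y⟫ ∉ (1/12)ℤ`. -/
theorem junk_obstruction {x y y' : EuclideanSpace ℝ (Fin 3)} (hx : x ∈ Yset) (hxK : x ∉ Kset) (hy : y ∈ Kset) (hy' : y' ∈ Kset) (hne : y ≠ y') (N : ℤ) :
    ⟪x - y, y' - y⟫_ℝ ≠ (N : ℝ) / 12 := by
  obtain ⟨j, rfl⟩ := mem_Yset_iff.1 hx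
  obtain ⟨i, hi, rfl⟩ := mem_Kset_iff.1 hy
  obtain ⟨i', hi', rfl⟩ := mem_Kset_iff.1 hy'
  have hj : 13 ≤ j.val := by
    by_contra h; exact hxK (mem_Kset (by omega))
  have hii : i ≠ i' := fun h => hne (by rw [h])
  have hden := tab_obst j i i' hj hi hi' hii
  intro h
  rw [← cubicVecQ_sub, ← cubicVecQ_sub, inner_cubicVecQ] at h
  have hq : (6 * qdot (Yc j - Yc i) (Yc i' - Yc i) : ℚ) = (N : ℚ) := by
    have : ((6 * qdot (Yc j - Yc i) (Yc i' - Yc i) : ℚ) : ℝ) = ((N : ℚ) : ℝ) := by push_cast; linarith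
    exact_mod_cast this
  exact hden (by rw [hq]; simp)

/-- Junk touches no two `K`-balls and no star: it is not a star site of any `D ⊆ K`, nor does it cap a unit triangle of `K`. -/
theorem not_capsTriangleIn_Kset_of_junk {x : EuclideanSpace ℝ (Fin 3)} (hx : x ∈ Yset) (hxK : x ∉ Kset) : ¬ CapsTriangleIn Kset x := by
  rintro ⟨a, ha, b, hb, -, -, hab, -, -, hxa, hxb, -⟩
  have := junk_contacts_eq hx hxK (Kset_subset_Yset ha) (Kset_subset_Yset hb) hxa hxb
  rw [this, dist_self] at hab
  exact zero_ne_one hab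

/-- A junk ball is not a star site of `K` (module obstruction). -/
theorem not_starSiteIn_Kset_of_junk {x : EuclideanSpace ℝ (Fin 3)} (hx : x ∈ Yset) (hxK : x ∉ Kset) : ¬ StarSiteIn Kset x := by
  intro h
  obtain ⟨y, hy, y₁, hy₁, hne, N, hN⟩ := inner_starSite_twelfth h
  exact junk_obstruction hx hxK hy hy₁ hne.symm N hN

/-- **`K` is cap-closed and star-closed in the window.** -/
theorem mem_Kset_of_capsTriangleIn {x : EuclideanSpace ℝ (Fin 3)} (hx : x ∈ Yset) (h : CapsTriangleIn Kset x) : x ∈ Kset := by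
  by_contra hxK; exact not_capsTriangleIn_Kset_of_junk hx hxK h

/-- `K` is star-closed in the window. -/
theorem mem_Kset_of_starSiteIn {x : EuclideanSpace ℝ (Fin 3)} (hx : x ∈ Yset) (h : StarSiteIn Kset x) : x ∈ Kset := by
  by_contra hxK; exact not_starSiteIn_Kset_of_junk hx hxK h

/-! ### The window systems -/

/-- The first window system of `UnionCoreSealedCapWin₃`: the basal system of the identity frame. -/
abbrev SB : PlateSystem := basalSystem (LinearIsometryEquiv.refl ℝ (EuclideanSpace ℝ (Fin 3)))

/-- The second window system: the basal system of the half-turn about `e₃`. -/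
abbrev SH : PlateSystem := basalSystem (ℝ ∙ EuclideanSpace.single (2 : Fin 3) (1 : ℝ)).reflection

/-- The roots of the first system are slots. -/
theorem SB_RT : SB.RT ⊆ fccSlots := Finset.filter_subset _ _
/-- The roots of the second system are slots. -/
theorem SH_RT : SH.RT ⊆ fccSlots := Finset.filter_subset _ _

/-- Basal slots by index: layer index `0` in the `(k, i, j)` table. -/
theorem slotSite_mem_basalHexagon {k : Fin 12} (hk : (slotKIJ k).1 = 0) : slotSite k ∈ basalHexagon := by
  rw [basalHexagon, Finset.mem_filter]
  refine ⟨slotSite_mem k, ?_⟩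
  rw [slotSite, Literature.MathematicalPhysics.StatisticalMechanics.barlowPos_apply_two, hk]
  simp

/-! ### A generic narrow (A)-end pair INTO the payer `0` -/

open scoped Classical in
/-- **Narrow movers into the payer.**  In a configuration `X ∋ 0` with at most eight contacts of `0`: a ball `q` with `q + d = 0`, predecessor `q − d ∈ X`, an admissible
class `(G, d)` of the first window system with `d = G w` a slot image NOT occupied at `0 + d`, and the positive triple of a menu normal `m` of `G` (`⟪d, m⟫ = √(2/3)`)
occupied around `q`, makes `(0, q)` an (A)-end pair: `q` reads NARROW onto `0`, and `0` is not moving (not full and not narrow since `d ∉ X`; not twin-reading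
since that needs nine occupied slots). -/
theorem isEndPairA_zero_of_data {X : Finset (EuclideanSpace ℝ (Fin 3))} (S₂ : PlateSystem) (G : EuclideanSpace ℝ (Fin 3) ≃ₗᵢ[ℝ] EuclideanSpace ℝ (Fin 3))
    {d q m : EuclideanSpace ℝ (Fin 3)} (hadm : SB.Adm G d) (hq : q ∈ X) (h0 : (0 : EuclideanSpace ℝ (Fin 3)) ∈ X) (hqd : q + d = 0) (hpred : q - d ∈ X)
    (hm : IsMenuNormal G m) (hdm : ⟪d, m⟫_ℝ = Real.sqrt (2 / 3)) (htri : ∀ w ∈ fccSlots, 0 < ⟪G w, m⟫_ℝ → q + G w ∈ X) (hslot : ∃ w ∈ fccSlots, d = G w)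
    (hdX : d ∉ X) (hdeg : (X.filter fun y => dist (0 : EuclideanSpace ℝ (Fin 3)) y = 1).card ≤ 8) :
    IsEndPairA X WordVersion.v2 SB S₂ 0 q ∧ HasTwoPayers X 0 ∧ IsNarrow X G d q ∧ ¬ IsMoving X WordVersion.v2 G d 0 := by
  have hpay : HasTwoPayers X 0 := Or.inl (hdeg.trans (by norm_num))
  have hnar : IsNarrow X G d q := ⟨by rw [hqd]; exact h0, m, hm, hdm, htri⟩
  have hnm : ¬ IsMoving X WordVersion.v2 G d 0 := by
    obtain ⟨w₀, hw₀, hdw⟩ := hslot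
    rintro (hfull | ⟨m', htw, hdm'⟩ | ⟨-, hnar'⟩)
    · exact hdX (by rw [hdw, ← zero_add (G w₀)]; exact hfull w₀ hw₀)
    · obtain ⟨⟨hm1, hmenu⟩, hlow, -, -⟩ := htw
      rcases hdm' with hpos | hzero
      · -- nine occupied non-positive slots
        obtain ⟨u₁, -, u₂, -, u₃, -, -, -, -, -, -, -, -, huniq⟩ := exists_far_frame G hm1 hmenu
        have hcard : 9 ≤ (fccSlots.filter fun w => ⟪G w, m'⟫_ℝ ≤ 0).card := by
          have hsub : (fccSlots.filter fun w => ¬ ⟪G w, m'⟫_ℝ ≤ 0) ⊆ {u₁, u₂, u₃} := by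
            intro w hw
            obtain ⟨hw, hlt⟩ := Finset.mem_filter.1 hw
            rcases huniq w hw (lt_of_not_ge hlt) with rfl | rfl | rfl <;> simp
          have h3 : (fccSlots.filter fun w => ¬ ⟪G w, m'⟫_ℝ ≤ 0).card ≤ 3 := (Finset.card_le_card hsub).trans Finset.card_le_three
          have hsplit := Finset.card_filter_add_card_filter_not (s := fccSlots) fun w => ⟪G w, m'⟫_ℝ ≤ 0
          rw [card_fccSlots] at hsplit
          omega
        have h9 : 9 ≤ (X.filter fun y => dist (0 : EuclideanSpace ℝ (Fin 3)) y = 1).card := by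
          refine hcard.trans (Finset.card_le_card_of_injOn (fun w => (0 : EuclideanSpace ℝ (Fin 3)) + G w) (fun w hw => ?_) ?_)
          · rw [Finset.mem_coe, Finset.mem_filter] at hw ⊢
            exact ⟨hlow w hw.1 hw.2, dist_slotSite_eq_one G 0 hw.1⟩
          · intro w₁ _ w₂ _ h
            exact G.injective (add_left_cancel h)
        omega
      · exact hdX (by rw [hdw, ← zero_add (G w₀)]; exact hlow w₀ hw₀ (by rw [← hdw, hzero]))
    · exact hdX (by simpa using hnar'.1)
  exact ⟨⟨hq, h0, hpay, G, d, Or.inl hadm, hpred, Or.inl ⟨Or.inr (Or.inl ⟨rfl, hnar⟩), hqd.symm, hnm⟩⟩, hpay, hnar, hnm⟩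

open scoped Classical in
/-- … and then the reader's piece carries the pair, so it lies in the union core, and the pair descends to the star-closed union core. -/
theorem pieceOf_subset_unionCore_of_data {X : Finset (EuclideanSpace ℝ (Fin 3))} (hX : ∀ p ∈ X, ∀ p' ∈ X, p ≠ p' → 1 ≤ dist p p')
    {S₂ : PlateSystem} (h₂ : S₂.RT ⊆ fccSlots) (G : EuclideanSpace ℝ (Fin 3) ≃ₗᵢ[ℝ] EuclideanSpace ℝ (Fin 3))
    {d q m : EuclideanSpace ℝ (Fin 3)} (hadm : SB.Adm G d) (hq : q ∈ X) (h0 : (0 : EuclideanSpace ℝ (Fin 3)) ∈ X) (hqd : q + d = 0) (hpred : q - d ∈ X)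
    (hm : IsMenuNormal G m) (hdm : ⟪d, m⟫_ℝ = Real.sqrt (2 / 3)) (htri : ∀ w ∈ fccSlots, 0 < ⟪G w, m⟫_ℝ → q + G w ∈ X) (hslot : ∃ w ∈ fccSlots, d = G w)
    (hdX : d ∉ X) (hdeg : (X.filter fun y => dist (0 : EuclideanSpace ℝ (Fin 3)) y = 1).card ≤ 8) :
    pieceOf X 0 q G ⊆ unionCore X 0 WordVersion.v2 SB S₂ := by
  obtain ⟨hp, hpay, hnar, hnm⟩ := isEndPairA_zero_of_data S₂ G hadm hq h0 hqd hpred hm hdm htri hslot hdX hdeg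
  have hzb : dist (0 : EuclideanSpace ℝ (Fin 3)) 0 ≤ 1 := by simp
  have hpP := isEndPairA_pieceOf_of_straight (v := WordVersion.v2) (z := (0 : EuclideanSpace ℝ (Fin 3))) hX SB_RT h₂ hzb hq h0 hpay (Or.inl hadm) hpred
    (Or.inr (Or.inl ⟨rfl, hnar⟩)) hqd.symm hnm
  exact pieceOf_subset_unionCore hzb hp hpP

/-- A reader-placement site: `q + G (slotSite k)` lies in the piece `pieceOf X 0 q G` when it is a ball of `X`. -/
theorem add_slot_mem_pieceOf {X : Finset (EuclideanSpace ℝ (Fin 3))} (hW : ∀ y ∈ X, dist (0 : EuclideanSpace ℝ (Fin 3)) y ≤ 3)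
    (G : EuclideanSpace ℝ (Fin 3) ≃ₗᵢ[ℝ] EuclideanSpace ℝ (Fin 3)) (q : EuclideanSpace ℝ (Fin 3)) (k : Fin 12) (hx : q + G (slotSite k) ∈ X) :
    q + G (slotSite k) ∈ pieceOf X 0 q G :=
  mem_pieceOf_of_slot_at G (p := q) (by rw [sub_self, map_zero]; exact ⟨0, 0, 0, 0, by simp⟩) (slotSite_mem k) hx (hW _ hx)

/-! ### The admissible classes used: empty chain, and one-letter chains -/

/-- Depth `0`: a basal slot `r` is admissible in the identity frame (empty chain). -/
theorem adm_refl {k : Fin 12} (hk : (slotKIJ k).1 = 0) : SB.Adm (LinearIsometryEquiv.refl ℝ (EuclideanSpace ℝ (Fin 3))) (slotSite k) := by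
  refine ⟨slotSite k, slotSite_mem_basalHexagon hk, [], ?_, ?_, ?_⟩
  · simp only [WFChain]
  · simp only [PlateSystem.Fw, basalSystem]
  · simp only [PlateSystem.Fw, basalSystem, List.length_nil, pow_zero, one_smul, LinearIsometryEquiv.coe_refl, id_eq]

/-- The one-letter frame of the cube normal `c`: `Fw [cubeNormal c] = (cubeRefl c).trans refl`. -/
def frame1 (c : Fin 8) : EuclideanSpace ℝ (Fin 3) ≃ₗᵢ[ℝ] EuclideanSpace ℝ (Fin 3) := SB.Fw [cubeNormal c]

/-- The one-letter frame acts as the reflection. -/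
theorem frame1_apply (c : Fin 8) (x : EuclideanSpace ℝ (Fin 3)) : frame1 c x = cubeRefl c x := by
  simp [frame1, PlateSystem.Fw, basalSystem, cubeRefl]

/-- The one-letter frame on rational cubic vectors. -/
theorem frame1_cubicVecQ (c : Fin 8) (a : Fin 3 → ℚ) : frame1 c (cubicVecQ a) = cubicVecQ (reflQ c a) := by
  rw [frame1_apply, cubeRefl_cubicVecQ]

/-- Depth `1`: for a basal root `r = slotSite k` crossing the plane of `cubeNormal c` upward (`r·c = 2`), the class `(Fw [cubeNormal c], −Fw [cubeNormal c] r)` is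
admissible. -/
theorem adm_frame1 {k : Fin 12} (hk : (slotKIJ k).1 = 0) (c : Fin 8) (hcross : qdot (slotQ k) (cubeQ c) = 2) : SB.Adm (frame1 c) (frame1 c (-slotSite k)) := by
  refine ⟨slotSite k, slotSite_mem_basalHexagon hk, [cubeNormal c], ?_, rfl, ?_⟩
  · refine ⟨trivial, norm_cubeNormal c, fun w hw => ?_, ?_, fun μ' κ' h => ?_⟩
    · simpa using (isMenuNormal_cubeNormal c).2 w hw
    · rw [List.length_nil, pow_zero, one_smul, slotSite_eq_cubicVecQ, inner_cubicVecQ_cubeNormal_eq_sqrt_iff]; exact hcross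
    · simp at h
  · simp [frame1]

end ZTerm

end Summit.Ventures.Crystal3D.Theorems

end
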